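import Summits.BirchSwinnertonDyer.BirchSwinnertonDyer.Theorems.Rank2Observatory2DescKillCheck
import HarnessLib

/-!
# KERNEL-2DESC — the LINEAR depth-2 kill certificate `l2Check` (rank-2 observatory, cert-1 gen 25, v3.1)

HONEST FRAMING: per-curve certified theorems and census instruments; no claim on BSD in rank ≥ 2.

The landed residue tree `TwoDescKill.killCheck p … fuel` certifies local insolubility of the quadric pair
`killQ = (Q₁, Q₂)` of a 2-descent class at `p` by enumerating, below every chart-normalised start vector
mod `p` that is alive (`Q ≡ 0 mod p`), all `p³` digit refinements mod `p²` (and deeper).  At the primes the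
K61 census finds new kills (`p = 29 … 113`, depth `2`) that costs `(p⁴−1)/(p−1) + s·p³ ≈ 2·10⁵ … 3·10⁶`
evaluations of `killQ` — beyond one kernel fact.  This file certifies the SAME mathematical statement
(no integer zero of `killQ` primitive at `p`; `killCheck_sound`'s conclusion, restated verbatim below) in
`O(p²)` evaluations of the cubic arithmetic plus `O(p³)` word operations:

* level 1 is scanned by ROWS `r̄ = (r₀, r₁, r₂)`: `z·r̄²` is evaluated once per row (`zsq`), and the `p`
  values `n` of the last coordinate only cost `A_j + t_j n²  (mod p)` (`rowQ`; `killQ_row`);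
* an alive level-1 node `s` is killed at level 2 by a LINEAR WITNESS `(l₁, l₂)`: with the polarisation
  `killQ (s + M δ) = killQ s + M·killB s δ + M²·killQ δ` (`killQ_expand`) and `killB s δ = Σ δ_k · killB s e_k`
  (`killB_lin`), if `l₁·killB s e_k + l₂·killB s e_k ≡ 0 (mod p)` for the four unit vectors and
  `l₁·(Q₁ s / p) + l₂·(Q₂ s / p) ≢ 0 (mod p)`, then NO `u ≡ s (mod p)` has `killQ u ≡ 0 (mod p²)`
  (`linDead`, `linDead_sound`) — `7` evaluations instead of `p³`.

`l2Check p a b c z t₁ t₂ W` (monolithic `decide` for `p ≲ 43`; for larger `p` assembled from one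
`decide` per `d₀`-block of chart 0: `blk`, `rows0`, `rows0_nil/cons`, `l2Check_of_rows0` — the kernel's memory, not its
time, bounds one `decide`) (the witness list `W : List ((ℤ×ℤ×ℤ×ℤ) × ℤ × ℤ)` is found by the producer,
`prod/k2l.py`, as a left-kernel vector of the Jacobian mod `p`) is evaluated by `decide` (in prefix blocks,
exactly like the frontier form); `l2Check_sound` has the signature of `killCheck_sound`, so
`TwoDescKill.KillValidAt` (v3.1 `Rank2Observatory2DescKillValid`) follows by `fun v h h0 => l2Check_sound hp hW v h h0`.
Scope: depth-2 kills at odd or even `p` whose alive level-1 nodes all have a witness (Jacobian rank ≤ 1 mod `p`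
and value vector outside its image); deeper kills stay with the tree / frontier forms.
[cite: CremonaAlgorithms1997, §3.6] [cite: Cassels1991LecturesEllipticCurves, §15]
-/

-- single-conjunct summit: `Summit.BirchSwinnertonDyer.BirchSwinnertonDyer.…` repeats the name by design
set_option linter.dupNamespace false

namespace Summit.BirchSwinnertonDyer.BirchSwinnertonDyer.Rank2Observatory.TwoDescKill

/-! ### Polarisation of the quadric pair -/

section Ring

variable {R : Type*} [CommRing R]

/-- The polar bilinear form of `killQ`: `killQ (v + w) = killQ v + killB v w + killQ w`. [folklore] -/
def killB (a b c : R) (z : R × R × R) (t₁ t₂ : R) (v w : R × R × R × R) : R × R :=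
  let m := mul3 a b c z (mul3 a b c (v.1, v.2.1, v.2.2.1) (w.1, w.2.1, w.2.2.1))
  (2 * m.2.1 + 2 * t₁ * v.2.2.2 * w.2.2.2, 2 * m.2.2 + 2 * t₂ * v.2.2.2 * w.2.2.2)

/-- **Taylor expansion to order 2**: `killQ (s + M δ) = killQ s + M·killB s δ + M²·killQ δ`,
componentwise. [folklore] -/
theorem killQ_expand (a b c : R) (z : R × R × R) (t₁ t₂ M : R) (s δ : R × R × R × R) :
    killQ a b c z t₁ t₂ (s.1 + M * δ.1, s.2.1 + M * δ.2.1, s.2.2.1 + M * δ.2.2.1, s.2.2.2 + M * δ.2.2.2) =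
      ((killQ a b c z t₁ t₂ s).1 + M * (killB a b c z t₁ t₂ s δ).1 + M ^ 2 * (killQ a b c z t₁ t₂ δ).1,
        (killQ a b c z t₁ t₂ s).2 + M * (killB a b c z t₁ t₂ s δ).2 + M ^ 2 * (killQ a b c z t₁ t₂ δ).2) := by
  simp only [killQ, killB, zsq, mul3]
  refine Prod.ext ?_ ?_ <;> (simp only; ring)

/-- `killB s` is linear: `killB s δ = Σ_k δ_k · killB s e_k`, componentwise. [folklore] -/
theorem killB_lin (a b c : R) (z : R × R × R) (t₁ t₂ : R) (s δ : R × R × R × R) :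
    killB a b c z t₁ t₂ s δ =
      (δ.1 * (killB a b c z t₁ t₂ s (1, 0, 0, 0)).1 + δ.2.1 * (killB a b c z t₁ t₂ s (0, 1, 0, 0)).1 +
          δ.2.2.1 * (killB a b c z t₁ t₂ s (0, 0, 1, 0)).1 + δ.2.2.2 * (killB a b c z t₁ t₂ s (0, 0, 0, 1)).1,
        δ.1 * (killB a b c z t₁ t₂ s (1, 0, 0, 0)).2 + δ.2.1 * (killB a b c z t₁ t₂ s (0, 1, 0, 0)).2 +
          δ.2.2.1 * (killB a b c z t₁ t₂ s (0, 0, 1, 0)).2 + δ.2.2.2 * (killB a b c z t₁ t₂ s (0, 0, 0, 1)).2) := by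
  simp only [killB, mul3]
  refine Prod.ext ?_ ?_ <;> (simp only; ring)

/-- The quadric pair along a row: `z·r̄²` computed once (`A`), then `A_j + t_j n²`. [folklore] -/
def rowQ (A : R × R × R) (t₁ t₂ n : R) : R × R := (A.2.1 + t₁ * n ^ 2, A.2.2 + t₂ * n ^ 2)

/-- `killQ (r₀, r₁, r₂, n) = rowQ (zsq z (r₀, r₁, r₂)) n`. [folklore] -/
theorem killQ_row (a b c : R) (z : R × R × R) (t₁ t₂ r₀ r₁ r₂ n : R) :
    killQ a b c z t₁ t₂ (r₀, r₁, r₂, n) = rowQ (zsq a b c z (r₀, r₁, r₂)) t₁ t₂ n := rfl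

end Ring

/-! ### The certificate -/

/-- **Linear level-2 witness** at an alive level-1 node `s` (modulus `p`): `killQ s ≡ 0 (mod p)`, the pair
`(l₁, l₂)` annihilates the four columns `killB s e_k` mod `p`, and does not annihilate `killQ s / p` mod `p`.
[cite: CremonaAlgorithms1997, §3.6] -/
def linDead (p : ℕ) (a b c : ℤ) (z : ℤ × ℤ × ℤ) (t₁ t₂ : ℤ) (s : ℤ × ℤ × ℤ × ℤ) (l₁ l₂ : ℤ) : Bool :=
  let q := killQ a b c z t₁ t₂ s
  let col := fun w : ℤ × ℤ × ℤ × ℤ =>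
    decide ((l₁ * (killB a b c z t₁ t₂ s w).1 + l₂ * (killB a b c z t₁ t₂ s w).2) % (p : ℤ) = 0)
  decide (q.1 % (p : ℤ) = 0) && decide (q.2 % (p : ℤ) = 0) &&
    col (1, 0, 0, 0) && col (0, 1, 0, 0) && col (0, 0, 1, 0) && col (0, 0, 0, 1) &&
    !decide ((l₁ * (q.1 / (p : ℤ)) + l₂ * (q.2 / (p : ℤ))) % (p : ℤ) = 0)

/-- A start vector is certified when it is dead mod `p` or a listed witness kills it at level 2. [folklore] -/
def node2 (p : ℕ) (a b c : ℤ) (z : ℤ × ℤ × ℤ) (t₁ t₂ : ℤ) (W : List ((ℤ × ℤ × ℤ × ℤ) × ℤ × ℤ))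
    (s : ℤ × ℤ × ℤ × ℤ) : Bool :=
  dead p (killQ a b c z t₁ t₂ s) ||
    W.any fun e => decide (e.1 = s) && linDead p a b c z t₁ t₂ s e.2.1 e.2.2

/-- A row of start vectors `(r₀, r₁, r₂, n)`, `n < p`: `z·r̄²` is shared by the `p` members. [folklore] -/
def row2 (p : ℕ) (a b c : ℤ) (z : ℤ × ℤ × ℤ) (t₁ t₂ : ℤ) (W : List ((ℤ × ℤ × ℤ × ℤ) × ℤ × ℤ))
    (r₀ r₁ r₂ : ℤ) : Bool :=
  let A := zsq a b c z (r₀, r₁, r₂)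
  (List.range p).all fun n =>
    dead p (rowQ A t₁ t₂ (n : ℤ)) ||
      W.any fun e => decide (e.1 = (r₀, r₁, r₂, (n : ℤ))) && linDead p a b c z t₁ t₂ (r₀, r₁, r₂, (n : ℤ)) e.2.1 e.2.2

/-- **The linear depth-2 kill certificate**: every chart-normalised residue vector mod `p` is dead at
level 1 or killed at level 2 by a listed linear witness. Same chart structure as `killCheck`.
[cite: CremonaAlgorithms1997, §3.6] -/
def l2Check (p : ℕ) (a b c : ℤ) (z : ℤ × ℤ × ℤ) (t₁ t₂ : ℤ) (W : List ((ℤ × ℤ × ℤ × ℤ) × ℤ × ℤ)) :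
    Bool :=
  ((List.range p).all fun d₀ => (List.range p).all fun d₁ => row2 p a b c z t₁ t₂ W 1 (d₀ : ℤ) (d₁ : ℤ)) &&
  ((List.range p).all fun d₁ => row2 p a b c z t₁ t₂ W 0 1 (d₁ : ℤ)) &&
  row2 p a b c z t₁ t₂ W 0 0 1 &&
  node2 p a b c z t₁ t₂ W (0, 0, 0, 1)

/-! ### Block form (one kernel `decide` per `d₀`-block of chart 0, for `p ≳ 43`) -/

/-- One `d₀`-block of chart 0: the `p` rows `(1, d₀, d₁)`, `d₁ < p`. [folklore] -/
def blk (p : ℕ) (a b c : ℤ) (z : ℤ × ℤ × ℤ) (t₁ t₂ : ℤ) (W : List ((ℤ × ℤ × ℤ × ℤ) × ℤ × ℤ)) (d₀ : ℕ) : Bool :=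
  (List.range p).all fun d₁ => row2 p a b c z t₁ t₂ W 1 (d₀ : ℤ) (d₁ : ℤ)

/-- Chart 0 over a list of `d₀` values, block by block. [folklore] -/
def rows0 (p : ℕ) (a b c : ℤ) (z : ℤ × ℤ × ℤ) (t₁ t₂ : ℤ) (W : List ((ℤ × ℤ × ℤ × ℤ) × ℤ × ℤ)) (ds : List ℕ) :
    Bool :=
  ds.all fun d₀ => blk p a b c z t₁ t₂ W d₀

/-- No block. [folklore] -/
theorem rows0_nil {p : ℕ} {a b c : ℤ} {z : ℤ × ℤ × ℤ} {t₁ t₂ : ℤ} {W : List ((ℤ × ℤ × ℤ × ℤ) × ℤ × ℤ)} :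
    rows0 p a b c z t₁ t₂ W [] = true := by
  simp [rows0]

/-- One more block (each block is its own kernel `decide`). [folklore] -/
theorem rows0_cons {p : ℕ} {a b c : ℤ} {z : ℤ × ℤ × ℤ} {t₁ t₂ : ℤ} {W : List ((ℤ × ℤ × ℤ × ℤ) × ℤ × ℤ)} {d₀ : ℕ}
    {ds : List ℕ} (h : blk p a b c z t₁ t₂ W d₀ = true) (hs : rows0 p a b c z t₁ t₂ W ds = true) :
    rows0 p a b c z t₁ t₂ W (d₀ :: ds) = true := by
  simp only [rows0, List.all_cons, Bool.and_eq_true] at hs ⊢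
  exact ⟨h, hs⟩

/-- **The certificate from its blocks**: chart 0 block by block over `ds = List.range p` (the list is written out by
the producer and identified by `decide`), charts 1–3 directly. [folklore] -/
theorem l2Check_of_rows0 {p : ℕ} {a b c : ℤ} {z : ℤ × ℤ × ℤ} {t₁ t₂ : ℤ} {W : List ((ℤ × ℤ × ℤ × ℤ) × ℤ × ℤ)}
    {ds : List ℕ} (hds : List.range p = ds) (h0 : rows0 p a b c z t₁ t₂ W ds = true)
    (h1 : ((List.range p).all fun d₁ => row2 p a b c z t₁ t₂ W 0 1 (d₁ : ℤ)) = true)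
    (h2 : row2 p a b c z t₁ t₂ W 0 0 1 = true) (h3 : node2 p a b c z t₁ t₂ W (0, 0, 0, 1) = true) :
    l2Check p a b c z t₁ t₂ W = true := by
  subst hds
  have h0' : ((List.range p).all fun d₀ => (List.range p).all fun d₁ =>
      row2 p a b c z t₁ t₂ W 1 (d₀ : ℤ) (d₁ : ℤ)) = true := h0
  simp only [l2Check, h0', h1, h2, h3, Bool.and_self]

/-! ### Soundness -/

/-- **Witness soundness**: a linear level-2 witness at `s` excludes every `u ≡ s (mod p)` with
`killQ u ≡ 0 (mod p²)`.  Proof: `u = s + p δ`; by `killQ_expand`, `p² ∣ killQ s + p·killB s δ + p²·killQ δ`,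
so `p ∣ killQ s / p + killB s δ` componentwise; pairing with `(l₁, l₂)` and expanding `killB s δ` over the
unit vectors (`killB_lin`) kills the `killB` term mod `p`, leaving `p ∣ l₁·(Q₁ s/p) + l₂·(Q₂ s/p)`,
which the certificate denies. [cite: CremonaAlgorithms1997, §3.6] -/
theorem linDead_sound {p : ℕ} (hp : 0 < p) {a b c : ℤ} {z : ℤ × ℤ × ℤ} {t₁ t₂ : ℤ}
    {s : ℤ × ℤ × ℤ × ℤ} {l₁ l₂ : ℤ} (h : linDead p a b c z t₁ t₂ s l₁ l₂ = true)
    {u : ℤ × ℤ × ℤ × ℤ} (h₀ : (p : ℤ) ∣ u.1 - s.1) (h₁ : (p : ℤ) ∣ u.2.1 - s.2.1)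
    (h₂ : (p : ℤ) ∣ u.2.2.1 - s.2.2.1) (h₃ : (p : ℤ) ∣ u.2.2.2 - s.2.2.2)
    (hz : ((p * p : ℕ) : ℤ) ∣ (killQ a b c z t₁ t₂ u).1 ∧ ((p * p : ℕ) : ℤ) ∣ (killQ a b c z t₁ t₂ u).2) :
    False := by
  have hp0 : (p : ℤ) ≠ 0 := by exact_mod_cast hp.ne'
  simp only [linDead, Bool.and_eq_true, Bool.not_eq_true', decide_eq_true_eq, decide_eq_false_iff_not] at h
  obtain ⟨⟨⟨⟨⟨⟨hq₁, hq₂⟩, hc₀⟩, hc₁⟩, hc₂⟩, hc₃⟩, hw⟩ := h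
  -- `u = s + p δ`
  obtain ⟨δ₀, e₀⟩ := h₀
  obtain ⟨δ₁, e₁⟩ := h₁
  obtain ⟨δ₂, e₂⟩ := h₂
  obtain ⟨δ₃, e₃⟩ := h₃
  have hu : u = (s.1 + (p : ℤ) * δ₀, s.2.1 + (p : ℤ) * δ₁, s.2.2.1 + (p : ℤ) * δ₂, s.2.2.2 + (p : ℤ) * δ₃) := by
    obtain ⟨u₀, u₁, u₂, u₃⟩ := u
    simp only at e₀ e₁ e₂ e₃
    refine Prod.ext ?_ (Prod.ext ?_ (Prod.ext ?_ ?_)) <;> simp only <;> linarith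
  set δ : ℤ × ℤ × ℤ × ℤ := (δ₀, δ₁, δ₂, δ₃) with hδ
  have hex := killQ_expand a b c z t₁ t₂ (p : ℤ) s δ
  simp only [hδ] at hex
  rw [hu, hex] at hz
  -- `killQ s = p • c`
  obtain ⟨c₁, hC₁⟩ := Int.dvd_of_emod_eq_zero hq₁
  obtain ⟨c₂, hC₂⟩ := Int.dvd_of_emod_eq_zero hq₂
  have hd₁ : (killQ a b c z t₁ t₂ s).1 / (p : ℤ) = c₁ := by rw [hC₁, Int.mul_ediv_cancel_left _ hp0]
  have hd₂ : (killQ a b c z t₁ t₂ s).2 / (p : ℤ) = c₂ := by rw [hC₂, Int.mul_ediv_cancel_left _ hp0]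
  rw [hd₁, hd₂] at hw
  -- divide the two congruences by `p`
  have hpp : ((p * p : ℕ) : ℤ) = (p : ℤ) * p := by push_cast; ring
  rw [hpp, hC₁, hC₂] at hz
  obtain ⟨⟨k₁, hk₁⟩, ⟨k₂, hk₂⟩⟩ := hz
  have g₁ : c₁ + (killB a b c z t₁ t₂ s (δ₀, δ₁, δ₂, δ₃)).1 + (p : ℤ) * (killQ a b c z t₁ t₂ (δ₀, δ₁, δ₂, δ₃)).1 =
      (p : ℤ) * k₁ := by
    apply mul_left_cancel₀ hp0
    linear_combination hk₁
  have g₂ : c₂ + (killB a b c z t₁ t₂ s (δ₀, δ₁, δ₂, δ₃)).2 + (p : ℤ) * (killQ a b c z t₁ t₂ (δ₀, δ₁, δ₂, δ₃)).2 =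
      (p : ℤ) * k₂ := by
    apply mul_left_cancel₀ hp0
    linear_combination hk₂
  -- expand `killB s δ` over the unit vectors and pair with the witness
  have hlin := killB_lin a b c z t₁ t₂ s (δ₀, δ₁, δ₂, δ₃)
  obtain ⟨m₀, hm₀⟩ := Int.dvd_of_emod_eq_zero hc₀
  obtain ⟨m₁, hm₁⟩ := Int.dvd_of_emod_eq_zero hc₁
  obtain ⟨m₂, hm₂⟩ := Int.dvd_of_emod_eq_zero hc₂
  obtain ⟨m₃, hm₃⟩ := Int.dvd_of_emod_eq_zero hc₃
  apply hw
  apply Int.emod_eq_zero_of_dvd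
  have hB := congrArg Prod.fst hlin
  have hB' := congrArg Prod.snd hlin
  simp only at hB hB'
  refine ⟨l₁ * k₁ + l₂ * k₂ - l₁ * (killQ a b c z t₁ t₂ (δ₀, δ₁, δ₂, δ₃)).1 -
      l₂ * (killQ a b c z t₁ t₂ (δ₀, δ₁, δ₂, δ₃)).2 - (δ₀ * m₀ + δ₁ * m₁ + δ₂ * m₂ + δ₃ * m₃), ?_⟩
  linear_combination l₁ * g₁ + l₂ * g₂ - l₁ * hB - l₂ * hB' - δ₀ * hm₀ - δ₁ * hm₁ - δ₂ * hm₂ - δ₃ * hm₃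

/-- **Start-vector soundness**: a certified start vector `s` (modulus `p`) has no `u ≡ s (mod p)` with
`killQ u ≡ 0 (mod p²)`. [cite: CremonaAlgorithms1997, §3.6] -/
theorem node2_sound {p : ℕ} (hp : 0 < p) {a b c : ℤ} {z : ℤ × ℤ × ℤ} {t₁ t₂ : ℤ}
    {W : List ((ℤ × ℤ × ℤ × ℤ) × ℤ × ℤ)} {s : ℤ × ℤ × ℤ × ℤ} (h : node2 p a b c z t₁ t₂ W s = true)
    (u : ℤ × ℤ × ℤ × ℤ) (h₀ : (p : ℤ) ∣ u.1 - s.1) (h₁ : (p : ℤ) ∣ u.2.1 - s.2.1)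
    (h₂ : (p : ℤ) ∣ u.2.2.1 - s.2.2.1) (h₃ : (p : ℤ) ∣ u.2.2.2 - s.2.2.2) :
    ¬ (((p * p ^ 1 : ℕ) : ℤ) ∣ (killQ a b c z t₁ t₂ u).1 ∧ ((p * p ^ 1 : ℕ) : ℤ) ∣ (killQ a b c z t₁ t₂ u).2) := by
  intro hz
  simp only [node2, Bool.or_eq_true, List.any_eq_true, Bool.and_eq_true, decide_eq_true_eq] at h
  rcases h with hd | ⟨e, -, he, hl⟩
  · exact dead_sound (M := p) hd h₀ h₁ h₂ h₃ ⟨(p : ℤ) ^ 1, by push_cast; ring⟩ hz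
  · rw [pow_one] at hz
    exact linDead_sound hp hl h₀ h₁ h₂ h₃ hz

/-- A certified row certifies each of its start vectors. [folklore] -/
theorem node2_of_row2 {p : ℕ} {a b c : ℤ} {z : ℤ × ℤ × ℤ} {t₁ t₂ : ℤ}
    {W : List ((ℤ × ℤ × ℤ × ℤ) × ℤ × ℤ)} {r₀ r₁ r₂ : ℤ} (h : row2 p a b c z t₁ t₂ W r₀ r₁ r₂ = true)
    {n : ℕ} (hn : n < p) : node2 p a b c z t₁ t₂ W (r₀, r₁, r₂, (n : ℤ)) = true := by
  simp only [row2, List.all_eq_true, List.mem_range] at h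
  have := h n hn
  rw [← killQ_row] at this
  simpa [node2] using this

/-- **Soundness of the linear depth-2 certificate**: if `l2Check p … W = true` for a prime `p`, then
`killQ` has no integer zero that is primitive at `p` — verbatim the conclusion of `killCheck_sound`, by the
same chart normalisation. [cite: CremonaAlgorithms1997, §3.6] -/
theorem l2Check_sound {p : ℕ} (hp : p.Prime) {a b c : ℤ} {z : ℤ × ℤ × ℤ} {t₁ t₂ : ℤ}
    {W : List ((ℤ × ℤ × ℤ × ℤ) × ℤ × ℤ)} (h : l2Check p a b c z t₁ t₂ W = true) (v : ℤ × ℤ × ℤ × ℤ)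
    (hprim : ¬ ((p : ℤ) ∣ v.1 ∧ (p : ℤ) ∣ v.2.1 ∧ (p : ℤ) ∣ v.2.2.1 ∧ (p : ℤ) ∣ v.2.2.2))
    (h0 : killQ a b c z t₁ t₂ v = 0) : False := by
  have hp0 : 0 < p := hp.pos
  have hpZ : Prime (p : ℤ) := Nat.prime_iff_prime_int.mp hp
  simp only [l2Check, Bool.and_eq_true, List.all_eq_true, List.mem_range] at h
  obtain ⟨⟨⟨hc0, hc1⟩, hc2⟩, hc3⟩ := h
  -- the modulus of the leaves and a unit normalising a coordinate prime to `p`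
  set N : ℕ := p * p ^ 1 with hN
  have unit_of : ∀ w : ℤ, ¬ (p : ℤ) ∣ w → ∃ l m : ℤ, l * w + m * (N : ℤ) = 1 := by
    intro w hw
    have hcop : IsCoprime w ((p : ℤ) ^ (1 + 1)) :=
      ((Prime.coprime_iff_not_dvd hpZ).mpr hw).symm.pow_right
    obtain ⟨l, m, hlm⟩ := hcop
    exact ⟨l, m, by rw [hN]; push_cast; linear_combination hlm⟩
  -- residues mod p as digits
  have digit : ∀ w : ℤ, ∃ d : ℕ, d < p ∧ (p : ℤ) ∣ w - d := by
    intro w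
    have hp' : (0 : ℤ) < p := by exact_mod_cast hp0
    refine ⟨(w % (p : ℤ)).toNat, ?_, w / p, ?_⟩
    · have := Int.emod_lt_of_pos w hp'; have := Int.emod_nonneg w hp'.ne'; omega
    · rw [Int.toNat_of_nonneg (Int.emod_nonneg w hp'.ne')]
      linear_combination (-1 : ℤ) * Int.emod_add_ediv_mul w (p : ℤ)
  -- the scaled vector `u = l • v` with the chart coordinate replaced by `1` is a zero mod `N`
  have scaled : ∀ (l m w : ℤ), l * w + m * (N : ℤ) = 1 → ∀ u : ℤ × ℤ × ℤ × ℤ,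
      (N : ℤ) ∣ u.1 - l * v.1 → (N : ℤ) ∣ u.2.1 - l * v.2.1 → (N : ℤ) ∣ u.2.2.1 - l * v.2.2.1 →
      (N : ℤ) ∣ u.2.2.2 - l * v.2.2.2 →
      ((p * p ^ 1 : ℕ) : ℤ) ∣ (killQ a b c z t₁ t₂ u).1 ∧
        ((p * p ^ 1 : ℕ) : ℤ) ∣ (killQ a b c z t₁ t₂ u).2 := by
    intro l m w _ u g₀ g₁ g₂ g₃
    have hc := killQ_congr a b c z t₁ t₂ N (v := (l * v.1, l * v.2.1, l * v.2.2.1, l * v.2.2.2))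
      g₀ g₁ g₂ g₃
    rw [killQ_smul, h0] at hc
    simpa [hN] using hc
  have hpN : (p : ℤ) ∣ (N : ℤ) := ⟨(p : ℤ) ^ 1, by rw [hN]; push_cast; ring⟩
  by_cases hv0 : (p : ℤ) ∣ v.1
  · by_cases hv1 : (p : ℤ) ∣ v.2.1
    · by_cases hv2 : (p : ℤ) ∣ v.2.2.1
      · -- chart 3
        have hv3 : ¬ (p : ℤ) ∣ v.2.2.2 := fun h3 => hprim ⟨hv0, hv1, hv2, h3⟩
        obtain ⟨l, m, hlm⟩ := unit_of _ hv3
        have hz := scaled l m _ hlm (l * v.1, l * v.2.1, l * v.2.2.1, 1) (by simp) (by simp) (by simp)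
          ⟨m, by linear_combination -hlm⟩
        refine node2_sound hp0 hc3 (l * v.1, l * v.2.1, l * v.2.2.1, 1) ?_ ?_ ?_ (by simp) hz
        · simpa using (dvd_mul_of_dvd_right hv0 l)
        · simpa using (dvd_mul_of_dvd_right hv1 l)
        · simpa using (dvd_mul_of_dvd_right hv2 l)
      · -- chart 2
        obtain ⟨l, m, hlm⟩ := unit_of _ hv2
        obtain ⟨d₂, hd₂, e₂⟩ := digit (l * v.2.2.2)
        have hz := scaled l m _ hlm (l * v.1, l * v.2.1, 1, l * v.2.2.2) (by simp) (by simp)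
          ⟨m, by linear_combination -hlm⟩ (by simp)
        refine node2_sound hp0 (node2_of_row2 hc2 hd₂) (l * v.1, l * v.2.1, 1, l * v.2.2.2) ?_ ?_ (by simp)
          (by simpa using e₂) hz
        · simpa using (dvd_mul_of_dvd_right hv0 l)
        · simpa using (dvd_mul_of_dvd_right hv1 l)
    · -- chart 1
      obtain ⟨l, m, hlm⟩ := unit_of _ hv1
      obtain ⟨d₁, hd₁, e₁⟩ := digit (l * v.2.2.1)
      obtain ⟨d₂, hd₂, e₂⟩ := digit (l * v.2.2.2)
      have hz := scaled l m _ hlm (l * v.1, 1, l * v.2.2.1, l * v.2.2.2) (by simp)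
        ⟨m, by linear_combination -hlm⟩ (by simp) (by simp)
      refine node2_sound hp0 (node2_of_row2 (hc1 d₁ hd₁) hd₂) (l * v.1, 1, l * v.2.2.1, l * v.2.2.2) ?_
        (by simp) (by simpa using e₁) (by simpa using e₂) hz
      simpa using (dvd_mul_of_dvd_right hv0 l)
  · -- chart 0
    obtain ⟨l, m, hlm⟩ := unit_of _ hv0
    obtain ⟨d₀, hd₀, e₀⟩ := digit (l * v.2.1)
    obtain ⟨d₁, hd₁, e₁⟩ := digit (l * v.2.2.1)
    obtain ⟨d₂, hd₂, e₂⟩ := digit (l * v.2.2.2)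
    have hz := scaled l m _ hlm (1, l * v.2.1, l * v.2.2.1, l * v.2.2.2)
      ⟨m, by linear_combination -hlm⟩ (by simp) (by simp) (by simp)
    exact node2_sound hp0 (node2_of_row2 (hc0 d₀ hd₀ d₁ hd₁) hd₂) (1, l * v.2.1, l * v.2.2.1, l * v.2.2.2)
      (by simp) (by simpa using e₀) (by simpa using e₁) (by simpa using e₂) hz

end Summit.BirchSwinnertonDyer.BirchSwinnertonDyer.Rank2Observatory.TwoDescKill
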